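import Summits.AtomisticToContinuum.HydrodynamicLimit.Theorems.RelayRaceLocalityLightConeInLawSVCLine
import Literature.MathematicalPhysics.KineticTheory.HardSphereEulerLLN

/-!
# The Poissonised count law of the hard-sphere gas is a count family

Helper file (`--supports stmt-AtomisticToContinuum-12500`) of the line `susceptibility-variance-continuity`
of the crux `LightConeInLaw`, for the stub `stub_countLCLT`: the dictionary between the line's vocabulary
(`canonicalWeights`, `countWeight`, `wZ`, `wP`) and the canonical hard-core gas of
`Literature/MathematicalPhysics/KineticTheory/HardSphereCanonicalTorus` (`Xi`).

* `efR_firstLabels_eq`, `Xi_eq_Xi_self`, `Xi_self_succ_le`: the hard-core probability of the first `k`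
  of `n` labels is that of `k` labels (marginalisation), so `n ↦ Ξ(n) = Xi P ε n n` is nonincreasing.
* `hsDiameter_rescale`, `rescale_pow_three`: the diameter `ε` is `hsDiameter σ' (L-1)` for
  `σ' = ε L^{1/3}`, `σ'³ = ε³ L` (to read the tree's statics, written along `ε_N = σ (N+1)^{-1/3}`, at
  any number `L` of labels).
* `canonicalWeights_eq`: `canonicalWeights σ₁ f N n = (∫a)ⁿ Ξ(n)/n!` for the local Gibbs profile `f` of
  `(a, u, θ)` (`canonicalPartition_eq_posPartition`, `posPartition_eq`).
* `countWeight_countFamily`: for `μ > 0` the count law `p = countWeight σ₁ f μ N` is a probability weight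
  with `p(0) > 0` and `(n+1) p(n+1) = ν g(n) p(n)`, `ν = μ ∫a`, `g(n) = Ξ(n+1)/Ξ(n) ∈ [0, 1]`.
-/

namespace Summit.AtomisticToContinuum.HydrodynamicLimit.Theorems.LightConeInLawSVC.CountLCLT

open scoped BigOperators
open MeasureTheory
open Literature.MathematicalPhysics.KineticTheory Literature.Analysis.FluidPDE Literature.Analysis.FunctionSpaces
open Literature.Probability.LatticeModels Literature.MathematicalPhysics.StatisticalMechanics
open Summit.AtomisticToContinuum.HydrodynamicLimit.Theorems.LightConeInLawSketch
open Summit.AtomisticToContinuum.HydrodynamicLimit.Theorems.LightConeInLawSVC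

noncomputable section

/-! ### Marginalisation of the hard-core probability -/

/-- Restricting a configuration to the first `k` labels transports the hard-core indicator of the block
`firstLabels n k` to that of all labels. [folklore] -/
theorem efR_firstLabels_eq {k n : ℕ} (h : k ≤ n) (ε : ℝ) (x : Fin n → T3) :
    efR (Ov ε) x (firstLabels n k) = efR (Ov ε) (fun i : Fin k => x (Fin.castLE h i)) Finset.univ := by
  unfold efR
  rw [← map_castLEEmb_univ h, edgeFreeInd_map (Fin.castLEEmb h)
    (H := overlapRel (Ov ε) (fun i : Fin k => x (Fin.castLE h i))) (H' := overlapRel (Ov ε) x)]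
  intro a b
  simp only [overlapRel, Fin.coe_castLEEmb, (Fin.castLE_injective h).ne_iff]

/-- **Marginalisation**: the hard-core probability of the first `k` of `n` independent points is the
hard-core probability of `k` points. [folklore] -/
theorem Xi_eq_Xi_self (P : DensityProfile) (ε : ℝ) {k n : ℕ} (h : k ≤ n) : Xi P ε n k = Xi P ε k k := by
  rw [Xi, Xi, firstLabels_self, ← integral_efR P.μ (measurableSet_ov ε),
    ← integral_efR P.μ (measurableSet_ov ε)]
  have hF : Measurable fun y : Fin k → T3 => efR (Ov ε) y Finset.univ := measurable_efR (measurableSet_ov ε) _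
  rw [← integral_pi_comp_castLE P h hF]
  exact integral_congr_ae (ae_of_all _ fun x => efR_firstLabels_eq h ε x)

/-- `n ↦ Ξ(n) = Xi P ε n n` is nonincreasing. [folklore] -/
theorem Xi_self_succ_le (P : DensityProfile) (ε : ℝ) (n : ℕ) : Xi P ε (n + 1) (n + 1) ≤ Xi P ε n n := by
  rw [← Xi_eq_Xi_self P ε (Nat.le_succ n)]
  exact Xi_succ_le n

/-! ### Reading a diameter along the scaling `hsDiameter` -/

/-- `hsDiameter (ε L^{1/3}) (L - 1) = ε` for `L ≥ 1`. [folklore] -/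
theorem hsDiameter_rescale (ε : ℝ) {L : ℕ} (hL : 1 ≤ L) :
    hsDiameter (ε * (L : ℝ) ^ (1 / 3 : ℝ)) (L - 1) = ε := by
  have hL0 : (0 : ℝ) < L := by exact_mod_cast hL
  have hcast : ((L - 1 + 1 : ℕ) : ℝ) = L := by rw [Nat.sub_add_cancel hL]
  rw [hsDiameter, hcast, Real.rpow_neg hL0.le, mul_assoc,
    mul_inv_cancel₀ (Real.rpow_pos_of_pos hL0 _).ne', mul_one]

/-- `(ε L^{1/3})³ = ε³ L`. [folklore] -/
theorem rescale_pow_three (ε : ℝ) (L : ℕ) : (ε * (L : ℝ) ^ (1 / 3 : ℝ)) ^ 3 = ε ^ 3 * L := by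
  have hL0 : (0 : ℝ) ≤ L := Nat.cast_nonneg L
  rw [mul_pow]
  congr 1
  rw [← Real.rpow_natCast ((L : ℝ) ^ (1 / 3 : ℝ)) 3, ← Real.rpow_mul hL0]
  norm_num

/-! ### The canonical weights through the canonical hard-core gas -/

variable {a θ : T3 → ℝ} {u : T3 → V3}

/-- **The canonical weights are `(∫a)ⁿ Ξ(n)/n!`** for the local Gibbs profile of `(a, u, θ)` with `a, θ > 0`
continuous. [folklore] -/
theorem canonicalWeights_eq (ha : Continuous a) (hθ : Continuous θ) (hu : Continuous u) (ha0 : ∀ x, 0 < a x)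
    (hθ0 : ∀ x, 0 < θ x) (σ₁ : ℝ) (N n : ℕ) :
    canonicalWeights σ₁ (localGibbsProfile a u θ) N n =
      (∫ y, a y) ^ n * Xi (profileOf a ha ha0) (hsDiameter σ₁ N) n n / (n.factorial : ℝ) := by
  rw [canonicalWeights, G3, canonicalPartition_eq_posPartition ha hθ hu (fun x => (ha0 x).le) hθ0,
    posPartition_eq ha ha0]

/-- **THE POISSONISED COUNT LAW IS A COUNT FAMILY** (registered helper `countWeight_countFamily` of the line
`susceptibility-variance-continuity`). For continuous `a, θ > 0`, `u` and an activity `μ > 0`, the count law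
`p = countWeight σ₁ f μ N` of the profile `f = localGibbsProfile a u θ` is a probability weight on `ℕ` with
`p(0) > 0` satisfying `(n+1) p(n+1) = ν g(n) p(n)` with `ν = μ ∫a` and the insertion probabilities
`g(n) = Ξ(n+1)/Ξ(n) ∈ [0, 1]`, `Ξ(n) = Xi (profileOf a) (hsDiameter σ₁ N) n n`. [folklore] -/
theorem countWeight_countFamily :
    ∀ (a θ : T3 → ℝ) (u : T3 → V3) (ha : Continuous a) (_hθ : Continuous θ) (_hu : Continuous u)
      (ha0 : ∀ x, 0 < a x) (_hθ0 : ∀ x, 0 < θ x) (σ₁ μ : ℝ) (N : ℕ), 0 < μ →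
      (∀ n, 0 ≤ countWeight σ₁ (localGibbsProfile a u θ) μ N n) ∧
      HasSum (countWeight σ₁ (localGibbsProfile a u θ) μ N) 1 ∧
      0 < countWeight σ₁ (localGibbsProfile a u θ) μ N 0 ∧
      (∀ n, countWeight σ₁ (localGibbsProfile a u θ) μ N (n + 1) * ((n : ℝ) + 1) =
        (μ * ∫ y, a y) * (Xi (profileOf a ha ha0) (hsDiameter σ₁ N) (n + 1) (n + 1) /
          Xi (profileOf a ha ha0) (hsDiameter σ₁ N) n n) * countWeight σ₁ (localGibbsProfile a u θ) μ N n) ∧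
      (∀ n, 0 ≤ Xi (profileOf a ha ha0) (hsDiameter σ₁ N) (n + 1) (n + 1) /
          Xi (profileOf a ha ha0) (hsDiameter σ₁ N) n n) ∧
      (∀ n, Xi (profileOf a ha ha0) (hsDiameter σ₁ N) (n + 1) (n + 1) /
          Xi (profileOf a ha ha0) (hsDiameter σ₁ N) n n ≤ 1) := by
  intro a θ u ha hθ hu ha0 hθ0 σ₁ μ N hμ
  set P : DensityProfile := profileOf a ha ha0 with hP
  set ε : ℝ := hsDiameter σ₁ N with hε
  set c : ℝ := ∫ y, a y with hc
  have hc0 : 0 < c := integral_pos_of_continuous_pos ha ha0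
  set w : ℕ → ℝ := canonicalWeights σ₁ (localGibbsProfile a u θ) N with hw
  have hwn : ∀ n, w n = c ^ n * Xi P ε n n / (n.factorial : ℝ) := fun n =>
    canonicalWeights_eq ha hθ hu ha0 hθ0 σ₁ N n
  have hΞ0 : ∀ n, 0 ≤ Xi P ε n n := fun n => Xi_nonneg _
  have hΞ1 : ∀ n, Xi P ε n n ≤ 1 := fun n => Xi_le_one _
  -- the unnormalised weights `t n = w n μⁿ = νⁿ Ξ(n)/n!`, `ν = μ c`
  have ht : ∀ n, w n * μ ^ n = (μ * c) ^ n * Xi P ε n n / (n.factorial : ℝ) := by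
    intro n; rw [hwn n, mul_pow]; ring
  have ht0 : ∀ n, 0 ≤ w n * μ ^ n := fun n => by rw [ht n]; have := hΞ0 n; positivity
  have hts : Summable fun n => w n * μ ^ n := by
    refine Summable.of_nonneg_of_le ht0 (fun n => ?_) (Real.summable_pow_div_factorial (μ * c))
    rw [ht n]
    calc (μ * c) ^ n * Xi P ε n n / (n.factorial : ℝ) ≤ (μ * c) ^ n * 1 / (n.factorial : ℝ) := by
          gcongr; exact hΞ1 n
      _ = (μ * c) ^ n / (n.factorial : ℝ) := by rw [mul_one]
  have hZ : wZ w μ = ∑' n, w n * μ ^ n := rfl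
  have hZ1 : 1 ≤ wZ w μ := by
    have h := hts.le_tsum 0 fun j _ => ht0 j
    rw [ht 0] at h
    rw [hZ]
    simpa [Xi_zero] using h
  have hZ0 : 0 < wZ w μ := one_pos.trans_le hZ1
  have hp : ∀ n, countWeight σ₁ (localGibbsProfile a u θ) μ N n = w n * μ ^ n / wZ w μ := fun n => rfl
  refine ⟨fun n => ?_, ?_, ?_, fun n => ?_, fun n => ?_, fun n => ?_⟩
  · rw [hp n]; exact div_nonneg (ht0 n) hZ0.le
  · have h := hts.hasSum.div_const (wZ w μ)
    rw [← hZ, div_self hZ0.ne'] at h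
    exact h.congr_fun fun n => (hp n).symm ▸ rfl
  · rw [hp 0, ht 0]; simp only [pow_zero, Xi_zero, Nat.factorial_zero, Nat.cast_one, mul_one, div_one]
    positivity
  · rw [hp (n + 1), hp n, ht (n + 1), ht n]
    have hfac : ((n + 1).factorial : ℝ) = ((n : ℝ) + 1) * (n.factorial : ℝ) := by
      rw [Nat.factorial_succ, Nat.cast_mul]; push_cast; ring
    rw [hfac]
    by_cases hΞ : Xi P ε n n = 0
    · have hΞ' : Xi P ε (n + 1) (n + 1) = 0 :=
        le_antisymm (hΞ ▸ Xi_self_succ_le P ε n) (hΞ0 _)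
      rw [hΞ, hΞ']; simp
    · have hn1 : (0 : ℝ) < (n : ℝ) + 1 := by positivity
      have hnf : (0 : ℝ) < (n.factorial : ℝ) := by positivity
      field_simp
      ring
  · exact div_nonneg (hΞ0 _) (hΞ0 _)
  · by_cases hΞ : Xi P ε n n = 0
    · rw [hΞ, div_zero]; exact zero_le_one
    · rw [div_le_one (lt_of_le_of_ne (hΞ0 n) (Ne.symm hΞ))]
      exact Xi_self_succ_le P ε n

end

end Summit.AtomisticToContinuum.HydrodynamicLimit.Theorems.LightConeInLawSVC.CountLCLT
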